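import Mathlib
import Summits.Ventures.PercRepro2.Defs
import Summits.Ventures.PercRepro2.Independence
import Summits.Ventures.PercRepro2.Harris
import Summits.Ventures.PercRepro2.Graph
import Summits.Ventures.PercRepro2.Events
import Summits.Ventures.PercRepro2.ZCTwoEdge

/-!
# Opening one edge, and contraction as a weight-one edge (blind cell PercRepro2, mine-a g26;
MINE-A.md §75 — the contraction lemma the |R| = 4 reductions of (ZC) need)

The degree-two reductions of (ZC) with a mark between two NON-marks `w`, `w₂` (MINE-A.md §74.10:
THEOREM K and its mirrors) take as inductive hypotheses (ZC) on `G − v` AND on the CONTRACTION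
`G − v / w w₂`.  In the fixed-`(V, E)` vocabulary of the lane a contraction is a weight-ONE edge: the
graph `(ends, p)` with `ends f = s(w, w₂)` and `p f = 1` has the connection and cluster events of
`G / w w₂`.  This file gives the pointwise facts (`conn_update_true_iff`: connections after opening
`f` are the connections off `f`, or pass through `f`; `cluster_update_true_eq_of_conn`,
`cluster_update_true_eq_of_not_conn`, `cluster_update_true_merge`: the clusters after opening `f`)
and their probability form (`prob_eq_openOne_of_one`: a weight-one edge may be assumed open;
`prob_connEvent_of_one`, `prob_clusterInEvent_of_one`).  No definition; one seat.
-/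

namespace Summit.Ventures.PercRepro2

section OpenOneEdge

variable {V : Type*} {E : Type*} [DecidableEq E]

/-- **Opening one edge `f = {w, w₂}`**: `x ↔ y` in `ω[f ↦ open]` iff `x ↔ y` in `ω[f ↦ closed]`, or
the connection passes through `f` (`x ↔ w` and `w₂ ↔ y`, or `x ↔ w₂` and `w ↔ y`, off `f`). -/
theorem conn_update_true_iff {ends : E → Sym2 V} {f : E} {w w₂ : V} (hf : ends f = s(w, w₂))
    (ω : Config E) (x y : V) :
    Conn ends (Function.update ω f true) x y ↔
      Conn ends (Function.update ω f false) x y ∨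
      (Conn ends (Function.update ω f false) x w ∧ Conn ends (Function.update ω f false) w₂ y) ∨
      (Conn ends (Function.update ω f false) x w₂ ∧ Conn ends (Function.update ω f false) w y) := by
  have hle := update_false_le_update_true ω f
  constructor
  · intro h
    refine mem_of_conn_of_closed (ends := ends) (ω := Function.update ω f true)
      (S := {z | Conn ends (Function.update ω f false) x z ∨
        (Conn ends (Function.update ω f false) x w ∧ Conn ends (Function.update ω f false) w₂ z) ∨
        (Conn ends (Function.update ω f false) x w₂ ∧ Conn ends (Function.update ω f false) w z)})
      ?_ (Or.inl (conn_refl _ _ _)) h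
    intro a ha b hab
    obtain ⟨_, e, he, hends⟩ := openGraph_adj.1 hab
    simp only [Set.mem_setOf_eq] at ha ⊢
    by_cases hef : e = f
    · rw [hef, hf, Sym2.eq_iff] at hends
      rcases hends with ⟨rfl, rfl⟩ | ⟨rfl, rfl⟩
      · rcases ha with ha | ⟨ha, _⟩ | ⟨ha, _⟩
        · exact Or.inr (Or.inl ⟨ha, conn_refl _ _ _⟩)
        · exact Or.inr (Or.inl ⟨ha, conn_refl _ _ _⟩)
        · exact Or.inl ha
      · rcases ha with ha | ⟨ha, _⟩ | ⟨ha, _⟩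
        · exact Or.inr (Or.inr ⟨ha, conn_refl _ _ _⟩)
        · exact Or.inl ha
        · exact Or.inr (Or.inr ⟨ha, conn_refl _ _ _⟩)
    · have he₀ : Function.update ω f false e = true := by
        rw [Function.update_of_ne hef]
        rw [Function.update_of_ne hef] at he
        exact he
      have hab₀ : Conn ends (Function.update ω f false) a b := conn_of_openAdj ⟨e, he₀, hends⟩
      rcases ha with ha | ⟨ha, ha'⟩ | ⟨ha, ha'⟩
      · exact Or.inl (conn_trans ha hab₀)
      · exact Or.inr (Or.inl ⟨ha, conn_trans ha' hab₀⟩)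
      · exact Or.inr (Or.inr ⟨ha, conn_trans ha' hab₀⟩)
  · have hww : Conn ends (Function.update ω f true) w w₂ :=
      conn_of_openAdj ⟨f, by simp, hf⟩
    rintro (h | ⟨h₁, h₂⟩ | ⟨h₁, h₂⟩)
    · exact conn_mono hle h
    · exact conn_trans (conn_mono hle h₁) (conn_trans hww (conn_mono hle h₂))
    · exact conn_trans (conn_mono hle h₁) (conn_trans (conn_symm hww) (conn_mono hle h₂))

/-- The cluster after opening `f = {w, w₂}`, for a vertex whose cluster off `f` meets `{w, w₂}`:
the three clusters off `f` merge. -/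
theorem cluster_update_true_eq_of_conn {ends : E → Sym2 V} {f : E} {w w₂ : V}
    (hf : ends f = s(w, w₂)) (ω : Config E) {x : V}
    (hx : Conn ends (Function.update ω f false) x w ∨ Conn ends (Function.update ω f false) x w₂) :
    cluster ends (Function.update ω f true) x =
      cluster ends (Function.update ω f false) x ∪ cluster ends (Function.update ω f false) w ∪
        cluster ends (Function.update ω f false) w₂ := by
  ext z
  simp only [mem_cluster, Set.mem_union]
  rw [conn_update_true_iff hf]
  constructor
  · rintro (h | ⟨_, h₂⟩ | ⟨_, h₂⟩)
    · exact Or.inl (Or.inl h)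
    · exact Or.inr h₂
    · exact Or.inl (Or.inr h₂)
  · rintro ((h | h) | h)
    · exact Or.inl h
    · rcases hx with hx | hx
      · exact Or.inl (conn_trans hx h)
      · exact Or.inr (Or.inr ⟨hx, h⟩)
    · rcases hx with hx | hx
      · exact Or.inr (Or.inl ⟨hx, h⟩)
      · exact Or.inl (conn_trans hx h)

/-- The cluster after opening `f = {w, w₂}`, for a vertex whose cluster off `f` avoids `{w, w₂}`:
unchanged. -/
theorem cluster_update_true_eq_of_not_conn {ends : E → Sym2 V} {f : E} {w w₂ : V}
    (hf : ends f = s(w, w₂)) (ω : Config E) {x : V}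
    (hx : ¬ Conn ends (Function.update ω f false) x w)
    (hx₂ : ¬ Conn ends (Function.update ω f false) x w₂) :
    cluster ends (Function.update ω f true) x = cluster ends (Function.update ω f false) x := by
  ext z
  simp only [mem_cluster]
  rw [conn_update_true_iff hf]
  constructor
  · rintro (h | ⟨h₁, _⟩ | ⟨h₁, _⟩)
    · exact h
    · exact absurd h₁ hx
    · exact absurd h₁ hx₂
  · exact fun h => Or.inl h

/-- **The merged vertex**: after opening `f = {w, w₂}` the cluster of `w` is the union of the two
clusters off `f`. -/
theorem cluster_update_true_merge {ends : E → Sym2 V} {f : E} {w w₂ : V}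
    (hf : ends f = s(w, w₂)) (ω : Config E) :
    cluster ends (Function.update ω f true) w =
      cluster ends (Function.update ω f false) w ∪ cluster ends (Function.update ω f false) w₂ := by
  rw [cluster_update_true_eq_of_conn hf ω (Or.inl (conn_refl _ _ _)), Set.union_self]

end OpenOneEdge

section WeightOne

variable {V : Type*} {E : Type*} [Fintype E] [DecidableEq E] {R : Type*} [CommRing R]

/-- A weight-one edge may be assumed open: `P(A) = P(ω[f ↦ open] ∈ A)` when `p f = 1`. -/
lemma prob_eq_openOne_of_one (p : E → R) {f : E} (hf : p f = 1) (A : Set (Config E)) :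
    prob p A = prob p {ω | Function.update ω f true ∈ A} := by
  have h := prob_update_one_eq_shift p f A
  rwa [← hf, Function.update_eq_self] at h

/-- **Contraction as a weight-one edge, connections**: with `p f = 1` and `ends f = {w, w₂}`, the
event `{x ↔ y}` has the probability of «`x ↔ y` off `f`, or `x ↔ w`, `w₂ ↔ y` off `f`, or `x ↔ w₂`,
`w ↔ y` off `f`». -/
theorem prob_connEvent_of_one (p : E → R) {ends : E → Sym2 V} {f : E} {w w₂ : V} (hf₁ : p f = 1)
    (hf : ends f = s(w, w₂)) (x y : V) :
    prob p (connEvent ends x y) = prob p {ω |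
      Conn ends (Function.update ω f false) x y ∨
      (Conn ends (Function.update ω f false) x w ∧ Conn ends (Function.update ω f false) w₂ y) ∨
      (Conn ends (Function.update ω f false) x w₂ ∧ Conn ends (Function.update ω f false) w y)} := by
  rw [prob_eq_openOne_of_one p hf₁]
  congr 1
  ext ω
  simp only [Set.mem_setOf_eq, mem_connEvent]
  exact conn_update_true_iff hf ω x y

open Classical in
/-- **Contraction as a weight-one edge, cluster events**: with `p f = 1` and `ends f = {w, w₂}`, the
event `{C(x) ∈ 𝓔}` has the probability of «the cluster of `x` off `f`, merged with the clusters of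
`w` and `w₂` off `f` when it meets `{w, w₂}`, lies in `𝓔`». -/
theorem prob_clusterInEvent_of_one (p : E → R) {ends : E → Sym2 V} {f : E} {w w₂ : V}
    (hf₁ : p f = 1) (hf : ends f = s(w, w₂)) (x : V) (𝓔 : Set (Set V)) :
    prob p (clusterInEvent ends x 𝓔) = prob p {ω |
      (if Conn ends (Function.update ω f false) x w ∨ Conn ends (Function.update ω f false) x w₂
        then cluster ends (Function.update ω f false) x ∪ cluster ends (Function.update ω f false) w ∪
          cluster ends (Function.update ω f false) w₂
        else cluster ends (Function.update ω f false) x) ∈ 𝓔} := by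
  rw [prob_eq_openOne_of_one p hf₁]
  congr 1
  ext ω
  simp only [Set.mem_setOf_eq, clusterInEvent]
  by_cases hx : Conn ends (Function.update ω f false) x w ∨ Conn ends (Function.update ω f false) x w₂
  · rw [if_pos hx, cluster_update_true_eq_of_conn hf ω hx]
  · rw [if_neg hx, cluster_update_true_eq_of_not_conn hf ω (not_or.1 hx).1 (not_or.1 hx).2]

end WeightOne

end Summit.Ventures.PercRepro2
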